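import Mathlib
import Summits.PneNP.PneNP.Theorems.CnfIdealGenLengthRankDefectRepresentationsMergeReduction

/-!
# Crux `RankDefectRepresentations` (stmt-PneNP-18923), line `rank-dehn-ladder`: the SPLIT REDUCTION — adjacent splitting implies the
# 2D max-cut decomposition (lead g15 RESHAPE 10, tool stub W4 `stub_splitReduction`; briefs `Cruxes/RankDefectRepresentations/Lines/rank-dehn-ladder-briefs-g15b.md` §W4)

ADJACENT SPLITTING (AS, the lead's `stub_adjacentSplitting`) with constant `C`: for a two-family instance `D` with `n` first-family and `n'' + 1`
second-family coordinates all of whose double bipartition cuts have rank `≤ c`, there is a matrix `G` VANISHING ON THE CROSS CELLS of the last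
second-family coordinate (cells whose row and column last bits differ), of rank `≤ C c`, such that the two HALVES `{last bit = b}` of `D − G`
(instances with `n''` second-family coordinates, `…MergeReduction.rowHalf / colHalf`, matrix `(D − G).submatrix Subtype.val Subtype.val`) have
double-cut budgets `c₀, c₁` with `c₀ + c₁ ≤ c`.

THE REDUCTION (`doubleMaxCut_of_adjacentSplitting_le`) is the un-crossing induction of `…MergeReduction.doubleMaxCut_of_merge_le` (p702065) with its
MERGE step replaced: at level `n'' + 1` with budget `c`, (1) the cross matrix `X` is an honest one-family instance, hence within rank `4c` of a
first-family block-diagonal `R′` (`exists_blockDiagonal_of_cuts_le`); (2) AS at level `n''` gives `G, c₀, c₁`; (3) the induction hypothesis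
decomposes each half of `D − G` with `rank L_b ≤ M(n'') c_b`, and the three pieces `S_I, S_J, L` of a half extend BY ZERO to the whole index set
keeping their support / rank properties (`exists_halfPieces`: a differing second-family coordinate inside a half is never the last one,
`exists_castSucc_ne`; ranks by `rank_pad_le`); (4) with `S_I := R′ + pad S_I⁰ + pad S_I¹`, `S_J := pad S_J⁰ + pad S_J¹` one has ENTRYWISE
`D − S_I − S_J = (X − R′) + G + pad L⁰ + pad L¹` (on cross cells `G` and all pads vanish and `X = D`; on a half cell `X = 0` and the pads of that
half sum to `D − G`), so `rank ≤ 4c + C c + M(n'')(c₀ + c₁) ≤ (4 + C + M(n'')) c`, i.e. `M(n'') = (4 + C) n''`.  With `C = C₀ (n+n'+1)^e`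
dominating the level constants `C₀ (n+n''+2)^e` (`n'' < n'`) this gives the registered conclusion with `L = 4 + C₀`, `e' = e + 1`
(`stub_splitReduction`, the registered signature verbatim).
HONEST FRAMING: elementary bookkeeping; AS (`stub_adjacentSplitting`) and the crux stay open; P ≠ NP is not moved; F-N2 is a FRONTIER formal rung.
-/

set_option linter.dupNamespace false -- `Summit.PneNP.PneNP.…`: summit = sub-problem name (D-0017)

namespace Summit.PneNP.PneNP.Theorems.CnfIdealGenLengthRankDefectRepresentationsSplitReduction

open Matrix Finset
open Summit.PneNP.PneNP.Theorems.CnfIdealGenLengthRankDefectRepresentationsMergeLowerBound (rank_add_le')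
open Summit.PneNP.PneNP.Theorems.CnfIdealGenLengthRankDefectRepresentationsCutLemmaMonotoneCuts (rank_pad_le)
open Summit.PneNP.PneNP.Theorems.CnfIdealGenLengthRankDefectRepresentationsDoubleMaxCutTwoClasses (exists_blockDiagonal_of_cuts_le)
open Summit.PneNP.PneNP.Theorems.CnfIdealGenLengthRankDefectRepresentationsTwoFamilyCutDomination
  (colourI colourJ maskJ doubleCut DoubleMaxCutDecomposition)
open Summit.PneNP.PneNP.Theorems.CnfIdealGenLengthRankDefectRepresentationsMergeReduction
  (lastR lastC uncross uncross_apply cross_add_uncross cross_cuts_le rowHalf colHalf liftJ exists_castSucc_ne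
    doubleMaxCutDecomposition_mono)

variable {K : Type} [Field K]

/-! ## Zero-extension of the three pieces of a half decomposition -/

section Tools

variable {ι ι' : Type} [Fintype ι] [Fintype ι'] [DecidableEq ι] [DecidableEq ι']

variable {n n' : ℕ} (row : ι → Fin n ⊕ Fin (n' + 1) → Bool) (col : ι' → Fin n ⊕ Fin (n' + 1) → Bool)

/-- **Zero-extension of a half decomposition, piece by piece.**  From `S_I, S_J` on the half `{last bit = b}` decomposing
`E|half = S_I + S_J + L` with `rank L ≤ m`: three matrices on the whole index set — `S_I'` vanishing wherever a first-family coordinate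
differs, `S_J'` vanishing wherever ANY second-family coordinate differs (inside the half a differing coordinate is not the last one; outside
it is zero anyway), `L'` of rank `≤ m` — whose sum is `E` on the cells of the half and `0` elsewhere. -/
theorem exists_halfPieces (b : Bool) (E : Matrix ι ι' K) (m : ℕ)
    (SI SJ : Matrix {x : ι // lastR row x = b} {y : ι' // lastC col y = b} K)
    (hSI : ∀ x y, (∃ k, rowHalf row b x (Sum.inl k) ≠ colHalf col b y (Sum.inl k)) → SI x y = 0)
    (hSJ : ∀ x y, (∃ k', rowHalf row b x (Sum.inr k') ≠ colHalf col b y (Sum.inr k')) → SJ x y = 0)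
    (hL : (E.submatrix Subtype.val Subtype.val - SI - SJ).rank ≤ m) :
    ∃ SI' SJ' L' : Matrix ι ι' K,
      (∀ x y, (∃ k, row x (Sum.inl k) ≠ col y (Sum.inl k)) → SI' x y = 0) ∧
      (∀ x y, (∃ k', row x (Sum.inr k') ≠ col y (Sum.inr k')) → SJ' x y = 0) ∧
      L'.rank ≤ m ∧
      ∀ x y, SI' x y + SJ' x y + L' x y =
        if row x (Sum.inr (Fin.last n')) = b ∧ col y (Sum.inr (Fin.last n')) = b then E x y else 0 := by
  set X : Matrix {x : ι // lastR row x = b} {y : ι' // lastC col y = b} K := E.submatrix Subtype.val Subtype.val - SI - SJ with hX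
  refine ⟨Matrix.of fun x y => if hx : lastR row x = b then (if hy : lastC col y = b then SI ⟨x, hx⟩ ⟨y, hy⟩ else 0) else 0,
    Matrix.of fun x y => if hx : lastR row x = b then (if hy : lastC col y = b then SJ ⟨x, hx⟩ ⟨y, hy⟩ else 0) else 0,
    Matrix.of fun x y => if hx : lastR row x = b then (if hy : lastC col y = b then X ⟨x, hx⟩ ⟨y, hy⟩ else 0) else 0,
    ?_, ?_, (rank_pad_le _ _ X).trans hL, ?_⟩
  · rintro x y ⟨k, hk⟩
    simp only [Matrix.of_apply]
    by_cases hx : lastR row x = b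
    · by_cases hy : lastC col y = b
      · rw [dif_pos hx, dif_pos hy]
        exact hSI _ _ ⟨k, hk⟩
      · rw [dif_pos hx, dif_neg hy]
    · rw [dif_neg hx]
  · rintro x y hJ
    simp only [Matrix.of_apply]
    by_cases hx : lastR row x = b
    · by_cases hy : lastC col y = b
      · rw [dif_pos hx, dif_pos hy]
        obtain ⟨k'', hk''⟩ := exists_castSucc_ne row col hx hy hJ
        exact hSJ _ _ ⟨k'', hk''⟩
      · rw [dif_pos hx, dif_neg hy]
    · rw [dif_neg hx]
  · intro x y
    simp only [Matrix.of_apply]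
    by_cases hx : lastR row x = b
    · by_cases hy : lastC col y = b
      · rw [dif_pos hx, dif_pos hy, dif_pos hx, dif_pos hy, dif_pos hx, dif_pos hy, if_pos ⟨hx, hy⟩, hX]
        simp only [Matrix.sub_apply, Matrix.submatrix_apply]
        ring
      · rw [dif_pos hx, dif_neg hy, dif_pos hx, dif_neg hy, dif_pos hx, dif_neg hy, if_neg (fun h => hy h.2)]
        ring
    · rw [dif_neg hx, dif_neg hx, dif_neg hx, if_neg (fun h => hx h.1)]
      ring

end Tools

/-! ## The reduction -/

/-- **ADJACENT SPLITTING ⟹ the 2D max-cut decomposition with a constant LINEAR in the number of second-family coordinates** (levels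
`≤ n'`; adjacent splitting with constant `C` is only needed below level `n'`): `DoubleMaxCutDecomposition K n n'' ((4 + C) n'')`. -/
theorem doubleMaxCut_of_adjacentSplitting_le {n n' C : ℕ}
    (hAS : ∀ n'', n'' < n' → ∀ (ι ι' : Type) [Fintype ι] [Fintype ι'] [DecidableEq ι] [DecidableEq ι']
      (row : ι → Fin n ⊕ Fin (n'' + 1) → Bool) (col : ι' → Fin n ⊕ Fin (n'' + 1) → Bool) (D : Matrix ι ι' K) (c : ℕ),
      (∀ B B', doubleCut row col B B' D ≤ c) →
      ∃ G : Matrix ι ι' K,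
        (∀ x y, row x (Sum.inr (Fin.last n'')) ≠ col y (Sum.inr (Fin.last n'')) → G x y = 0) ∧
        G.rank ≤ C * c ∧
        ∃ c₀ c₁ : ℕ, c₀ + c₁ ≤ c ∧
          (∀ B B', doubleCut (rowHalf row false) (colHalf col false) B B' ((D - G).submatrix Subtype.val Subtype.val) ≤ c₀) ∧
          (∀ B B', doubleCut (rowHalf row true) (colHalf col true) B B' ((D - G).submatrix Subtype.val Subtype.val) ≤ c₁)) :
    ∀ n'', n'' ≤ n' → DoubleMaxCutDecomposition K n n'' ((4 + C) * n'') := by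
  intro n''
  induction n'' with
  | zero =>
      intro _ ι ι' _ _ _ _ row col D c hc
      refine ⟨0, D, fun _ _ _ => rfl, ?_, by simp⟩
      rintro x y ⟨k', -⟩
      exact k'.elim0
  | succ n'' ih =>
      intro hle ι ι' _ _ _ _ row col D c hc
      classical
      have ih' := ih (Nat.le_of_succ_le hle)
      -- (1) the cross matrix is within `4c` of a first-family block-diagonal matrix
      set X : Matrix ι ι' K := Matrix.of fun x y => if lastR row x ≠ lastC col y then D x y else 0 with hXdef
      obtain ⟨R', hR', hXR'⟩ := exists_blockDiagonal_of_cuts_le (fun x => colourI (row x)) (fun y => colourI (col y)) X c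
        (cross_cuts_le row col D c hc)
      -- (2) adjacent splitting at level `n''`
      obtain ⟨G, hGcross, hGr, c₀, c₁, hc01, hc0, hc1⟩ := hAS n'' (Nat.lt_of_succ_le hle) ι ι' row col D c hc
      -- (3) the induction hypothesis on the two halves of `D - G`, extended by zero piece by piece
      have hhalf : ∀ (b : Bool) (cb : ℕ),
          (∀ B B', doubleCut (rowHalf row b) (colHalf col b) B B' ((D - G).submatrix Subtype.val Subtype.val) ≤ cb) →
          ∃ SI' SJ' L' : Matrix ι ι' K,
            (∀ x y, (∃ k, row x (Sum.inl k) ≠ col y (Sum.inl k)) → SI' x y = 0) ∧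
            (∀ x y, (∃ k', row x (Sum.inr k') ≠ col y (Sum.inr k')) → SJ' x y = 0) ∧
            L'.rank ≤ (4 + C) * n'' * cb ∧
            ∀ x y, SI' x y + SJ' x y + L' x y =
              if row x (Sum.inr (Fin.last n'')) = b ∧ col y (Sum.inr (Fin.last n'')) = b then (D - G) x y else 0 := by
        intro b cb hcb
        obtain ⟨SI, SJ, hSI, hSJ, hL⟩ :=
          ih' {x : ι // lastR row x = b} {y : ι' // lastC col y = b} (rowHalf row b) (colHalf col b)
            ((D - G).submatrix Subtype.val Subtype.val) cb hcb
        exact exists_halfPieces row col b (D - G) _ SI SJ hSI hSJ hL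
      obtain ⟨SI₀, SJ₀, L₀, hSI₀, hSJ₀, hL₀, he₀⟩ := hhalf false c₀ hc0
      obtain ⟨SI₁, SJ₁, L₁, hSI₁, hSJ₁, hL₁, he₁⟩ := hhalf true c₁ hc1
      -- (4) assemble
      refine ⟨R' + SI₀ + SI₁, SJ₀ + SJ₁, ?_, ?_, ?_⟩
      · rintro x y ⟨k, hk⟩
        have hne : colourI (row x) ≠ colourI (col y) := fun h => hk (congrFun h k)
        rw [Matrix.add_apply, Matrix.add_apply, hR' x y hne, hSI₀ x y ⟨k, hk⟩, hSI₁ x y ⟨k, hk⟩, add_zero, add_zero]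
      · intro x y hk
        rw [Matrix.add_apply, hSJ₀ x y hk, hSJ₁ x y hk, add_zero]
      · have e : D - (R' + SI₀ + SI₁) - (SJ₀ + SJ₁) = (X - R') + G + L₀ + L₁ := by
          ext x y
          have h0 := he₀ x y
          have h1 := he₁ x y
          have hG := hGcross x y
          simp only [Matrix.sub_apply, Matrix.add_apply, hXdef, Matrix.of_apply]
          simp only [Matrix.sub_apply] at h0 h1
          rcases Bool.eq_false_or_eq_true (row x (Sum.inr (Fin.last n''))) with hx | hx <;>
            rcases Bool.eq_false_or_eq_true (col y (Sum.inr (Fin.last n''))) with hy | hy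
          · -- both `true`: a half cell
            have hxy : row x (Sum.inr (Fin.last n'')) = col y (Sum.inr (Fin.last n'')) := by rw [hx, hy]
            rw [hx, hy] at h0 h1
            simp only [Bool.true_eq_false, and_self, if_false, if_true] at h0 h1
            rw [if_neg (not_not_intro hxy)]
            linear_combination -h0 - h1
          · -- cross cell
            have hxy : row x (Sum.inr (Fin.last n'')) ≠ col y (Sum.inr (Fin.last n'')) := by rw [hx, hy]; decide
            have hG0 : G x y = 0 := hG hxy
            rw [hx, hy] at h0 h1
            simp only [Bool.true_eq_false, Bool.false_eq_true, and_false, false_and, if_false] at h0 h1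
            rw [if_pos hxy]
            linear_combination -h0 - h1 - hG0
          · -- cross cell
            have hxy : row x (Sum.inr (Fin.last n'')) ≠ col y (Sum.inr (Fin.last n'')) := by rw [hx, hy]; decide
            have hG0 : G x y = 0 := hG hxy
            rw [hx, hy] at h0 h1
            simp only [Bool.true_eq_false, Bool.false_eq_true, and_false, false_and, if_false] at h0 h1
            rw [if_pos hxy]
            linear_combination -h0 - h1 - hG0
          · -- both `false`: a half cell
            have hxy : row x (Sum.inr (Fin.last n'')) = col y (Sum.inr (Fin.last n'')) := by rw [hx, hy]
            rw [hx, hy] at h0 h1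
            simp only [Bool.false_eq_true, and_self, if_false, if_true] at h0 h1
            rw [if_neg (not_not_intro hxy)]
            linear_combination -h0 - h1
        rw [e]
        calc ((X - R') + G + L₀ + L₁).rank ≤ (X - R').rank + G.rank + L₀.rank + L₁.rank :=
              (rank_add_le' _ _).trans (Nat.add_le_add_right ((rank_add_le' _ _).trans (Nat.add_le_add_right (rank_add_le' _ _) _)) _)
          _ ≤ 4 * c + C * c + (4 + C) * n'' * c₀ + (4 + C) * n'' * c₁ :=
              Nat.add_le_add (Nat.add_le_add (Nat.add_le_add hXR' hGr) hL₀) hL₁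
          _ = 4 * c + C * c + (4 + C) * n'' * (c₀ + c₁) := by ring
          _ ≤ 4 * c + C * c + (4 + C) * n'' * c := Nat.add_le_add_left (Nat.mul_le_mul_left _ hc01) _
          _ = (4 + C) * (n'' + 1) * c := by ring

/-- **TOOL stub W4 `stub_splitReduction` (lead g15 RESHAPE 10), the registered signature verbatim: ADJACENT SPLITTING with a constant
`C₀ (n+n'+2)^e` polynomial in the number of coordinates implies the registered 2D max-cut decomposition
`∃ L e', ∀ K n n', DoubleMaxCutDecomposition K n n' (L (n+n'+1)^{e'})`, with `L = 4 + C₀`, `e' = e + 1`.** -/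
theorem stub_splitReduction :
    ∀ C₀ e : ℕ, (∀ (K : Type) [Field K] (n n' : ℕ),
      (∀ (ι ι' : Type) [Fintype ι] [Fintype ι'] [DecidableEq ι] [DecidableEq ι']
          (row : ι → Fin n ⊕ Fin (n' + 1) → Bool) (col : ι' → Fin n ⊕ Fin (n' + 1) → Bool) (D : Matrix ι ι' K) (c : ℕ),
          (∀ B B', Summit.PneNP.PneNP.Theorems.CnfIdealGenLengthRankDefectRepresentationsTwoFamilyCutDomination.doubleCut row col B B' D ≤ c) →
          ∃ G : Matrix ι ι' K,
            (∀ x y, row x (Sum.inr (Fin.last n')) ≠ col y (Sum.inr (Fin.last n')) → G x y = 0) ∧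
            G.rank ≤ (C₀ * (n + n' + 2) ^ e) * c ∧
            ∃ c₀ c₁ : ℕ, c₀ + c₁ ≤ c ∧
              (∀ B B', Summit.PneNP.PneNP.Theorems.CnfIdealGenLengthRankDefectRepresentationsTwoFamilyCutDomination.doubleCut
                  (Summit.PneNP.PneNP.Theorems.CnfIdealGenLengthRankDefectRepresentationsMergeReduction.rowHalf row false)
                  (Summit.PneNP.PneNP.Theorems.CnfIdealGenLengthRankDefectRepresentationsMergeReduction.colHalf col false) B B'
                  ((D - G).submatrix Subtype.val Subtype.val) ≤ c₀) ∧
              (∀ B B', Summit.PneNP.PneNP.Theorems.CnfIdealGenLengthRankDefectRepresentationsTwoFamilyCutDomination.doubleCut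
                  (Summit.PneNP.PneNP.Theorems.CnfIdealGenLengthRankDefectRepresentationsMergeReduction.rowHalf row true)
                  (Summit.PneNP.PneNP.Theorems.CnfIdealGenLengthRankDefectRepresentationsMergeReduction.colHalf col true) B B'
                  ((D - G).submatrix Subtype.val Subtype.val) ≤ c₁))) →
      ∃ L e' : ℕ, ∀ (K : Type) [Field K] (n n' : ℕ),
        Summit.PneNP.PneNP.Theorems.CnfIdealGenLengthRankDefectRepresentationsTwoFamilyCutDomination.DoubleMaxCutDecomposition K n n' (L * (n + n' + 1) ^ e') := by
  intro C₀ e hAS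
  refine ⟨4 + C₀, e + 1, fun K _ n n' => ?_⟩
  -- below level `n'` the splitting constants are dominated by the level-independent `C := C₀ (n + n' + 1)^e`
  have hAS' : ∀ n'', n'' < n' → ∀ (ι ι' : Type) [Fintype ι] [Fintype ι'] [DecidableEq ι] [DecidableEq ι']
      (row : ι → Fin n ⊕ Fin (n'' + 1) → Bool) (col : ι' → Fin n ⊕ Fin (n'' + 1) → Bool) (D : Matrix ι ι' K) (c : ℕ),
      (∀ B B', doubleCut row col B B' D ≤ c) →
      ∃ G : Matrix ι ι' K,
        (∀ x y, row x (Sum.inr (Fin.last n'')) ≠ col y (Sum.inr (Fin.last n'')) → G x y = 0) ∧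
        G.rank ≤ (C₀ * (n + n' + 1) ^ e) * c ∧
        ∃ c₀ c₁ : ℕ, c₀ + c₁ ≤ c ∧
          (∀ B B', doubleCut (rowHalf row false) (colHalf col false) B B' ((D - G).submatrix Subtype.val Subtype.val) ≤ c₀) ∧
          (∀ B B', doubleCut (rowHalf row true) (colHalf col true) B B' ((D - G).submatrix Subtype.val Subtype.val) ≤ c₁) := by
    intro n'' hn'' ι ι' _ _ _ _ row col D c hc
    obtain ⟨G, hG, hGr, c₀, c₁, h01, h0, h1⟩ := hAS K n n'' ι ι' row col D c hc
    refine ⟨G, hG, hGr.trans (Nat.mul_le_mul_right c ?_), c₀, c₁, h01, h0, h1⟩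
    exact Nat.mul_le_mul_left C₀ (Nat.pow_le_pow_left (by omega) e)
  refine doubleMaxCutDecomposition_mono (doubleMaxCut_of_adjacentSplitting_le hAS' n' le_rfl) ?_
  calc (4 + C₀ * (n + n' + 1) ^ e) * n'
      ≤ (4 * (n + n' + 1) ^ e + C₀ * (n + n' + 1) ^ e) * (n + n' + 1) := by
        apply Nat.mul_le_mul _ (by omega)
        apply Nat.add_le_add_right
        exact Nat.le_mul_of_pos_right 4 (pow_pos (by omega) e)
    _ = (4 + C₀) * (n + n' + 1) ^ (e + 1) := by ring

end Summit.PneNP.PneNP.Theorems.CnfIdealGenLengthRankDefectRepresentationsSplitReduction
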